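import Literature.Algebra.Homology.OrderedCechSystemAlternatingDifferential
import Mathlib.GroupTheory.Perm.Sign
import Mathlib.Algebra.BigOperators.Group.Finset.Piecewise
import HarnessLib

/-!
# Refinement of ordered Čech cochains is FUNCTORIAL in the index map: `θ'^♯ ∘ θ^♯ = (θ ∘ θ')^♯` on cochains
# (The Stacks Project, Tags 01FG, 01FP; Godement II §5.8; Serre FAC n° 20)

Layer `Algebra/Homology` (pure algebra; THEOREMS only: no definition, no instance, no notation, no named fact, no `sorry`).
Cell `hodgecm-mathlib` FLOOR 0, P1 sub-line F-11, packet (iv)∕J3, (G1) «pull-backs on classes», letter **(G1-c)** (F0P1b-plan (g0)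
(R75)(b); letter B-p10 (g15) 2026-08-31; B-p09 (g18)).  HC_CM is proved only modulo the 7 printed citations until rung 0 closes —
nothing here bears on a summit statement.

Setting: ★ core-1 `Algebra/Homology/OrderedCechSystemAlternating(Differential)` (F0P1b-p01 (g0)): systems `M : Finset ι ⥤ ModuleCat A`
on finite linearly ordered index sets, ordered cochains `SysCochain M n`, the ALTERNATING extension `SysCochain.altEvalAt g α t`
(`= (-1)^{inv α} · g_{{α}}|_t` on an injective tuple `α`, `0` on a tuple with a repeated index) and the refinement of cochains along an
ARBITRARY map of index sets `refineCochain θ φ n g` (component at `{j₀<⋯<j_n}` = `φ (g(θ j₀,…,θ j_n))`).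

* §1 **`neg_one_pow_inv_perm`** — for a permutation `π` of `Fin m`, `(-1)^{inv π} = sgn π` (our inversion count ★ `OrderedCech.inv`
  against Mathlib's `Equiv.Perm.sign`, through `Equiv.Perm.signAux` = the parity of the same set of pairs); `inv_strictMono_comp`
  (`inv (e ∘ ρ) = inv ρ` for strictly increasing `e`); `exists_perm_eq_orderEmbOfFin_comp` (an injective tuple is its sorted
  enumeration composed with a permutation of positions); `neg_one_pow_inv_comp_perm` (`(-1)^{inv (γ ∘ π)} = sgn π · (-1)^{inv γ}`).
* §2 **`SysCochain.altEvalAt_comp_perm`** — THE ALTERNATING RULE ([StacksProject, Tag 01FG] «`s_{σ(i₀)…σ(i_p)} = sgn(σ) s_{i₀…i_p}`»):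
  `g.altEvalAt (γ ∘ π) t = sgn π • g.altEvalAt γ t` for EVERY tuple `γ` and every permutation `π` of positions; and the value of a
  refined cochain `θ^♯ g` on an arbitrary injective tuple `β` with `{β} = s'`: `(θ^♯ g)(β)|_{s'} = φ_{s'} (g(θ ∘ β))`
  (`altEvalAt_refineCochain_of_injective`).
* §3 **`refineCochain_comp`** — FUNCTORIALITY OF REFINEMENT ON COCHAINS ([StacksProject, Tag 01FP]): for `θ : ι' → ι` with datum
  `φ : imageFunctor θ ⋙ M ⟶ M'` and `θ' : ι'' → ι'` with datum `φ' : imageFunctor θ' ⋙ M' ⟶ M''`, and ANY datum `φc` for `θ ∘ θ'`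
  CHARACTERISED as the composite `φc_{s''} = φ'_{s''} ∘ φ_{θ'(s'')} ∘ M(θθ'(s'') = θ(θ'(s'')))`, one has, ON THE NOSE (not just up to
  homotopy), `refineCochain θ' φ' n (refineCochain θ φ n g) = refineCochain (θ ∘ θ') φc n g`; linear-map form `refineLinear_comp`.
  (The index maps are arbitrary — not monotone, not injective: the refined tuple `θ'(j₀ < ⋯ < j_n)` is re-sorted by §2.)

## References
* The Stacks Project, Tag 01FG (alternating Čech complex; `s_{σ(i)} = sgn(σ) s_i`), Tag 01FP (refinements and their composites). [StacksProject]
* R. Godement, *Topologie algébrique et théorie des faisceaux* (1958), II §5.8. [folklore]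
* U. Görtz, T. Wedhorn, *Algebraic Geometry II* (2023), Def. 21.64, Def. 21.68 (pp. 179–181). [GortzWedhorn2023]
-/

universe v u

open CategoryTheory

set_option backward.isDefEq.respectTransparency false -- `ModuleCat`-valued functors (as in ★ `OrderedCechSystem`)

noncomputable section

namespace Literature.Algebra.Homology

namespace OrderedCech

variable {ι : Type} [LinearOrder ι]

/-! ## §1 Inversions of permutations of positions: `(-1)^{inv π} = sgn π` -/

section Perm

variable {m : ℕ}

/-- Composing with a strictly increasing map on the left does not change the inversions of a tuple of positions:
`inv (e ∘ ρ) = inv ρ`. [cite: StacksProject, Tag 01FG] -/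
theorem inv_strictMono_comp {e : Fin m → ι} (he : StrictMono e) (ρ : Fin m → Fin m) : inv (e ∘ ρ) = inv ρ := by
  unfold inv
  congr 1
  ext ⟨p, q⟩
  simp only [Finset.mem_filter, Finset.mem_univ, true_and, Function.comp_apply, he.lt_iff_lt]

/-- Mathlib's two signs of a permutation of `Fin m` agree: `Equiv.Perm.signAux π = Equiv.Perm.sign π`. [folklore] -/
private theorem signAux_eq_sign (π : Equiv.Perm (Fin m)) : Equiv.Perm.signAux π = Equiv.Perm.sign π := by
  induction π using Equiv.Perm.swap_induction_on with
  | one => rw [Equiv.Perm.signAux_one, Equiv.Perm.sign_one]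
  | swap_mul f x y hxy ih =>
    rw [Equiv.Perm.signAux_mul, ih, Equiv.Perm.sign_mul, Equiv.Perm.signAux_swap hxy, Equiv.Perm.sign_swap hxy]

/-- `Equiv.Perm.signAux π` is `(-1)` to the number of inversions of `π`: both count the pairs of positions `p < q` with
`π q < π p`. [folklore] -/
private theorem signAux_eq_neg_one_pow_inv (π : Equiv.Perm (Fin m)) :
    Equiv.Perm.signAux π = (-1 : ℤˣ) ^ inv (⇑π) := by
  unfold Equiv.Perm.signAux inv
  rw [Finset.prod_ite, Finset.prod_const_one, mul_one, Finset.prod_const]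
  congr 1
  refine Finset.card_bij (fun x _ => (x.2, x.1)) ?_ ?_ ?_
  · rintro ⟨a₁, a₂⟩ hx
    simp only [Finset.mem_filter, Equiv.Perm.mem_finPairsLT] at hx
    simp only [Finset.mem_filter, Finset.mem_univ, true_and]
    exact ⟨hx.1, lt_of_le_of_ne hx.2 fun h => (ne_of_lt hx.1).symm (π.injective h)⟩
  · rintro ⟨a₁, a₂⟩ - ⟨b₁, b₂⟩ - h
    simp only [Prod.mk.injEq] at h
    obtain ⟨rfl, rfl⟩ := h
    rfl
  · rintro ⟨p, q⟩ hpq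
    simp only [Finset.mem_filter, Finset.mem_univ, true_and] at hpq
    exact ⟨⟨q, p⟩, by simp only [Finset.mem_filter, Equiv.Perm.mem_finPairsLT]; exact ⟨hpq.1, hpq.2.le⟩, rfl⟩

/-- **`(-1)^{inv π} = sgn π`** for a permutation `π` of `Fin m`: our inversion count ★ `OrderedCech.inv` (pairs of positions
`p < q` with `π q < π p`) has the parity of Mathlib's `Equiv.Perm.sign` (through `Equiv.Perm.signAux`, the product over the
same pairs). [cite: StacksProject, Tag 01FG] -/
theorem neg_one_pow_inv_perm {A : Type u} [CommRing A] (π : Equiv.Perm (Fin m)) :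
    (-1 : A) ^ inv (⇑π) = ((Equiv.Perm.sign π : ℤ) : A) := by
  rw [← signAux_eq_sign, signAux_eq_neg_one_pow_inv, Units.val_pow_eq_pow_val, Units.val_neg, Units.val_one,
    Int.cast_pow, Int.cast_neg, Int.cast_one]

/-- The image of an injective `m`-tuple has `m` elements. [cite: StacksProject, Tag 01FG] -/
theorem card_image_of_injective_fin {β : Fin m → ι} (hβ : Function.Injective β) :
    (Finset.univ.image β).card = m := by
  classical
  rw [Finset.card_image_of_injective _ hβ, Finset.card_univ, Fintype.card_fin]

/-- **An injective tuple is its sorted enumeration composed with a permutation of positions**: for `β : Fin m → ι`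
injective with image `s` (so `#s = m`), `β = e_s ∘ ρ` for a (unique) permutation `ρ` of `Fin m`, `e_s = s.orderEmbOfFin h`.
[cite: StacksProject, Tag 01FG] -/
theorem exists_perm_eq_orderEmbOfFin_comp {β : Fin m → ι} (hβ : Function.Injective β) (s : Finset ι)
    (hs : Finset.univ.image β = s) (h : s.card = m) :
    ∃ ρ : Equiv.Perm (Fin m), β = ⇑(s.orderEmbOfFin h) ∘ ⇑ρ := by
  classical
  have hmem : ∀ j, β j ∈ s := fun j => hs ▸ Finset.mem_image_of_mem β (Finset.mem_univ j)
  let ρ₀ : Fin m → Fin m := fun j => (s.orderIsoOfFin h).symm ⟨β j, hmem j⟩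
  have hρ₀ : ∀ j, s.orderEmbOfFin h (ρ₀ j) = β j := fun j => by
    rw [← Finset.coe_orderIsoOfFin_apply, OrderIso.apply_symm_apply]
  have hinj : Function.Injective ρ₀ := fun i j hij => hβ (by rw [← hρ₀ i, ← hρ₀ j, hij])
  refine ⟨Equiv.ofBijective ρ₀ (Finite.injective_iff_bijective.mp hinj), funext fun j => ?_⟩
  exact (hρ₀ j).symm

/-- **Permuting the positions of an injective tuple multiplies its sign by the sign of the permutation**:
`(-1)^{inv (γ ∘ π)} = sgn π · (-1)^{inv γ}`. [cite: StacksProject, Tag 01FG] -/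
theorem neg_one_pow_inv_comp_perm {A : Type u} [CommRing A] {γ : Fin m → ι} (hγ : Function.Injective γ)
    (π : Equiv.Perm (Fin m)) :
    (-1 : A) ^ inv (γ ∘ ⇑π) = ((Equiv.Perm.sign π : ℤ) : A) * (-1) ^ inv γ := by
  have he := ((Finset.univ.image γ).orderEmbOfFin (card_image_of_injective_fin hγ)).strictMono
  obtain ⟨ρ, hρ⟩ := exists_perm_eq_orderEmbOfFin_comp hγ _ rfl (card_image_of_injective_fin hγ)
  rw [hρ, Function.comp_assoc, ← Equiv.Perm.coe_mul, inv_strictMono_comp he, inv_strictMono_comp he,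
    neg_one_pow_inv_perm, neg_one_pow_inv_perm, Equiv.Perm.sign_mul, Units.val_mul, Int.cast_mul]
  exact mul_comm _ _

/-- Permuting positions does not change the set of values of a tuple. [cite: StacksProject, Tag 01FG] -/
theorem image_comp_perm (γ : Fin m → ι) (π : Equiv.Perm (Fin m)) :
    Finset.univ.image (γ ∘ ⇑π) = Finset.univ.image γ := by
  classical
  rw [← Finset.image_image, Finset.image_univ_equiv]

end Perm

/-! ## §2 The alternating rule for the signed evaluation -/

section AltEval

variable {A : Type u} [CommRing A] {M : Finset ι ⥤ ModuleCat.{v} A} {n : ℤ} {m : ℕ}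

/-- **THE ALTERNATING RULE** `g(γ ∘ π) = sgn(π) · g(γ)`: permuting the positions of a tuple multiplies the signed value of an
ordered cochain by the sign of the permutation ([StacksProject, Tag 01FG]: «`s_{σ(i₀)…σ(i_p)} = sgn(σ) s_{i₀…i_p}`»); for a
tuple with a repeated index both sides vanish. [cite: StacksProject, Tag 01FG] -/
theorem SysCochain.altEvalAt_comp_perm (g : SysCochain M n) (γ : Fin m → ι) (π : Equiv.Perm (Fin m)) (t : Finset ι) :
    g.altEvalAt (γ ∘ ⇑π) t = ((Equiv.Perm.sign π : ℤ) : A) • g.altEvalAt γ t := by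
  classical
  by_cases hγ : Function.Injective γ
  · rw [g.altEvalAt_of_injective (hγ.comp π.injective), g.altEvalAt_of_injective hγ, image_comp_perm,
      neg_one_pow_inv_comp_perm hγ π, mul_smul]
  · have hγπ : ¬ Function.Injective (γ ∘ ⇑π) := fun h => hγ fun a b hab =>
      π.symm.injective (h (show γ (π (π.symm a)) = γ (π (π.symm b)) by
        rwa [Equiv.apply_symm_apply, Equiv.apply_symm_apply]))
    rw [g.altEvalAt_of_not_injective hγπ, g.altEvalAt_of_not_injective hγ, smul_zero]

variable {ι' : Type} [LinearOrder ι'] {M' : Finset ι' ⥤ ModuleCat.{v} A} (θ : ι' → ι) (φ : imageFunctor θ ⋙ M ⟶ M')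

/-- The proof of `s.card = c` in the sorted enumeration is irrelevant for the signed evaluation along `θ`. [cite: StacksProject, Tag 01FG] -/
theorem SysCochain.altEvalAt_comp_orderEmbOfFin_congr (g : SysCochain M n) (s : Finset ι') {c : ℕ} (h : s.card = c)
    (t : Finset ι) :
    g.altEvalAt (θ ∘ ⇑(s.orderEmbOfFin rfl)) t = g.altEvalAt (θ ∘ ⇑(s.orderEmbOfFin h)) t := by
  subst h
  rfl

/-- The set of values of the tuple `θ ∘ e_s` (sorted enumeration of `s`) is `θ(s)`. [cite: StacksProject, Tag 01FG] -/
theorem image_univ_comp_orderEmbOfFin (s : Finset ι') {c : ℕ} (h : s.card = c) :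
    Finset.univ.image (θ ∘ ⇑(s.orderEmbOfFin h)) = s.image θ := by
  classical
  rw [← Finset.image_image, Finset.image_orderEmbOfFin_univ]

/-- **The value of a refined cochain `θ^♯ g` on an arbitrary INJECTIVE tuple** `β : Fin k → ι'` whose set of values `s'`
is an `n`-simplex: `(θ^♯ g)(β)|_{s'} = φ_{s'} (g(θ ∘ β)|_{θ(s')})` — write `β = e_{s'} ∘ ρ`; the sign `(-1)^{inv β} = sgn ρ`
of the left side is the sign produced on the right by the alternating rule at `θ ∘ e_{s'}`. [cite: StacksProject, Tag 01FG] -/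
theorem SysCochain.altEvalAt_refineCochain_of_injective (g : SysCochain M n) {k : ℕ} {β : Fin k → ι'}
    (hβ : Function.Injective β) (s' : Finset ι') (hs' : s'.Nonempty ∧ (s'.card : ℤ) = n + 1)
    (hβs : Finset.univ.image β = s') :
    (refineCochain θ φ n g).altEvalAt β s' = (φ.app s').hom (g.altEvalAt (θ ∘ β) (s'.image θ)) := by
  classical
  have hc : s'.card = k := by rw [← hβs, card_image_of_injective_fin hβ]
  obtain ⟨ρ, hρ⟩ := exists_perm_eq_orderEmbOfFin_comp hβ s' hβs hc
  rw [SysCochain.altEvalAt_of_injective _ hβ, hβs,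
    show (refineCochain θ φ n g).ext0At s' s' = refineCochain θ φ n g ⟨s', hs'⟩ from
      SysCochain.ext0At_self (refineCochain θ φ n g) ⟨s', hs'⟩,
    show refineCochain θ φ n g ⟨s', hs'⟩ = (φ.app s').hom (g.altEvalAt (θ ∘ ⇑(s'.orderEmbOfFin hc)) (s'.image θ)) from
      (refineCochain_apply θ φ n g ⟨s', hs'⟩).trans
        (congrArg _ (SysCochain.altEvalAt_comp_orderEmbOfFin_congr θ g s' hc _)),
    hρ, inv_strictMono_comp (s'.orderEmbOfFin hc).strictMono, neg_one_pow_inv_perm, ← Function.comp_assoc,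
    SysCochain.altEvalAt_comp_perm, map_smul]

end AltEval

/-! ## §3 Functoriality of refinement on cochains -/

section Refine

variable {ι' : Type} [LinearOrder ι'] {ι'' : Type} [LinearOrder ι''] {A : Type u} [CommRing A]
  {M : Finset ι ⥤ ModuleCat.{v} A} {M' : Finset ι' ⥤ ModuleCat.{v} A} {M'' : Finset ι'' ⥤ ModuleCat.{v} A}
  (θ : ι' → ι) (φ : imageFunctor θ ⋙ M ⟶ M') (θ' : ι'' → ι') (φ' : imageFunctor θ' ⋙ M' ⟶ M'')

/-- **FUNCTORIALITY OF REFINEMENT ON COCHAINS** `θ'^♯ (θ^♯ g) = (θ ∘ θ')^♯ g` — for index maps `θ : ι' → ι`, `θ' : ι'' → ι'`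
with restriction data `φ`, `φ'` and ANY datum `φc` for the composite CHARACTERISED by `φc_{s''} = φ'_{s''} ∘ φ_{θ'(s'')} ∘ M(=)`,
the refinements of ORDERED cochains compose ON THE NOSE.  At a simplex `s'' = {j₀ < ⋯ < j_n}`: if `θ'` repeats a value on `s''`
both sides vanish; otherwise the tuple `θ'(j₀), …, θ'(j_n)` is the sorted enumeration of `θ'(s'')` composed with a permutation
`ρ` of positions, and the two signs `sgn ρ` — one from evaluating `θ^♯ g` on this unsorted tuple, one from the alternating rule
`altEvalAt_comp_perm` applied to `g` at `θ ∘ (e ∘ ρ)` — agree (`altEvalAt_refineCochain_of_injective`).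
[cite: StacksProject, Tag 01FP] [cite: StacksProject, Tag 01FG] -/
theorem refineCochain_comp (φc : imageFunctor (θ ∘ θ') ⋙ M ⟶ M'')
    (hφc : ∀ (s'' : Finset ι'') (x : M.obj (s''.image (θ ∘ θ'))),
      (φc.app s'').hom x = (φ'.app s'').hom ((φ.app (s''.image θ')).hom
        ((M.map (homOfLE (Finset.image_image.symm.le : s''.image (θ ∘ θ') ≤ (s''.image θ').image θ))).hom x)))
    (n : ℤ) (g : SysCochain M n) :
    refineCochain θ' φ' n (refineCochain θ φ n g) = refineCochain (θ ∘ θ') φc n g := by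
  classical
  funext σ''
  rw [refineCochain_apply, refineCochain_apply, hφc,
    SysCochain.map_altEvalAt g _ _ _ (image_univ_comp_orderEmbOfFin (θ ∘ θ') σ''.1 rfl).le]
  refine congrArg ((φ'.app σ''.1).hom) ?_
  by_cases hβ : Function.Injective (θ' ∘ ⇑(σ''.1.orderEmbOfFin rfl))
  · -- the refined tuple is injective: `θ'(s'')` is an `n`-simplex and both signs are `sgn ρ`
    have hs' : (σ''.1.image θ').Nonempty ∧ ((σ''.1.image θ').card : ℤ) = n + 1 :=
      ⟨σ''.2.1.image θ', by
        rw [← image_univ_comp_orderEmbOfFin θ' σ''.1 rfl, card_image_of_injective_fin hβ]; exact σ''.2.2⟩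
    rw [SysCochain.altEvalAt_refineCochain_of_injective θ φ g hβ _ hs' (image_univ_comp_orderEmbOfFin θ' σ''.1 rfl)]
    rfl
  · -- a repeated value: both sides vanish
    have hβ' : ¬ Function.Injective ((θ ∘ θ') ∘ ⇑(σ''.1.orderEmbOfFin rfl)) := fun h =>
      hβ fun a b hab => h (show θ ((θ' ∘ ⇑(σ''.1.orderEmbOfFin rfl)) a) = θ ((θ' ∘ ⇑(σ''.1.orderEmbOfFin rfl)) b) by
        rw [hab])
    rw [SysCochain.altEvalAt_of_not_injective _ hβ, SysCochain.altEvalAt_of_not_injective _ hβ', map_zero]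

/-- Functoriality of refinement, linear-map form: `refineLinear θ' φ' n ∘ₗ refineLinear θ φ n = refineLinear (θ ∘ θ') φc n`.
[cite: StacksProject, Tag 01FP] -/
theorem refineLinear_comp (φc : imageFunctor (θ ∘ θ') ⋙ M ⟶ M'')
    (hφc : ∀ (s'' : Finset ι'') (x : M.obj (s''.image (θ ∘ θ'))),
      (φc.app s'').hom x = (φ'.app s'').hom ((φ.app (s''.image θ')).hom
        ((M.map (homOfLE (Finset.image_image.symm.le : s''.image (θ ∘ θ') ≤ (s''.image θ').image θ))).hom x)))
    (n : ℤ) :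
    refineLinear θ' φ' n ∘ₗ refineLinear (M := M) θ φ n = refineLinear (θ ∘ θ') φc n :=
  LinearMap.ext fun g => refineCochain_comp θ φ θ' φ' φc hφc n g

end Refine

end OrderedCech

end Literature.Algebra.Homology

end
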